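/-
Copyright (c) 2026 the pub-hodgecm-mathlib formalisation cell (harness21).  Prover seat hodgecm-mathlib-LH4-p11 (g5), req620 Track A «(D-RAM) FOUR-FRAME» squad
(unit U2H_HSide, the (ρ2b′-X) road :418; bottom socket (A): the letters of O-Sign's `hA` model — brick 9b/9c).
-/
import Summits.HodgeConjecture.HodgeConjecture.Theorems.F0P3cDyRamHSideDescentRatio   -- ★ LH4-p09 (g5): `lam_mul_map_lam`
import HarnessLib

/-!
# Crux `H413`, line LH4 «(D-RAM) FOUR-FRAME» — the (ρ2b′-X) road, bottom socket (A): THE DESCENT LINE `j(F) ⊕ j(F)·𝔩` OF O-SIGN'S `hA` MODEL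

Cell `hodgecm-mathlib` (D-0151), FLOOR 0, crux item H413 = `stmt-HodgeConjecture-24833`; squad F0∕P3c∕LH4; bottom socket (A) (payer LH4-p14).  ★ p857454 (O-Sign,
`hilbertSymbol_token_eq_neg_one_pow`) takes the UNRAMIFIED-CLASS letter `hA` of `a = Tr λ′ − 2`; ★ p857525 `hilbertSymbol_eq_one_iff_even_of_unramifiedModel` reads it from a model:
`j : F → M` with `|j y| = |y|²`, an endomorphism `ρ` fixing `j(F)`, an element `𝔩` with `ρ𝔩 = −𝔩`, `j(a·c²) = 𝔩²`, and the line `j(F) ⊕ j(F)𝔩` (hKev, hKnorm).  THIS file supplies the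
ALGEBRA of that model in the letters of socket (A) — tower `F →ι E →jE M`, involutions `σ` (on `E`), `ρ, Θ` (on `M`, commuting), `Θ ∘ jE = jE ∘ σ`, `Fix ρ = jE(E)`:
* §1 `𝔩 := λ′ − ρλ′`, `λ′ := lam ∕ jE δ` (`δ² = D = det`, `σδ·δ = 1`, `lam·ρlam = jE D` ★ p09, `Θlam·lam = 1`): **`ρ𝔩 = −𝔩`, `Θ𝔩 = −𝔩`, `Θ(ρ𝔩) = 𝔩`**, and
  **`𝔩² = jE((t∕δ − 2)·((t∕δ − 2) + 4))`** with **`σ(t∕δ) = t∕δ`** (`t = D·σt`): so `a := ι⁻¹(t∕δ − 2)` and `c² = a + 4` give `j(a·c²) = 𝔩²`.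
* §2 **EVERY `Θρ`-FIXED `κ` IS `jE A₀ + jE B₀·𝔩` with `σA₀ = A₀`, `σB₀ = B₀`** (`A₀ := jE⁻¹((κ + ρκ)∕2)`, `B₀ := jE⁻¹((κ − ρκ)∕(2𝔩))`, both `ρ`- and `Θ`-fixed since `Θκ = ρκ`),
  hence `∈ j(F) ⊕ j(F)𝔩` once `σ`-fixed elements of `E` descend to `F` — the shape ★ p857525's `hKnorm` wants, fed by ★ p858220 (LH4-p14) `exists_thetaRho_fixed_unit_norm_eq`.
THEOREMS ONLY (no `def`, no instance, no notation, no `sorry`); lane `--supports stmt-HodgeConjecture-24833 --as helper` (count-neutral).  Generic fields.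
HONEST LABEL.  Count-neutral; nothing printed is asserted; (ρ2b′-X) stays OPEN; `HC_CM` is proved only modulo the 7 printed citations (2 remaining named inputs: hLiu418 =
`stmt-HodgeConjecture-24832`, h413 = `stmt-HodgeConjecture-24833`) until rung 0 closes.

## References
* [Rogawski1990] J. D. Rogawski, *Automorphic Representations of Unitary Groups in Three Variables*, Ann. of Math. Stud. 123 (1990), §4.9 p. 55, Lemma 4.9.3 p. 56.
* [LabesseLanglands1979] J.-P. Labesse, R. P. Langlands, *L-indistinguishability for SL(2)*, Canad. J. Math. 31 (1979), §2 pp. 8–10.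
* [Serre1979] J.-P. Serre, *Local Fields*, GTM 67 (1979), Ch. V §2 Prop. 3.
-/

set_option autoImplicit false

noncomputable section

namespace Summit.HodgeConjecture.HodgeConjecture.Cruxes.H413.F0P3cDyRamTypeASignModel

open Summit.HodgeConjecture.HodgeConjecture.Cruxes.H413.F0P3cDyRamHSideDescentRatio

/-! ## §1 The anti-invariant generator `𝔩 = λ′ − ρλ′` and the letter `a + 2 = t∕δ` -/

section Line

variable {E M : Type*} [Field E] [Field M] (σ : E →+* E) (jE : E →+* M) (ρ Θ : M →+* M)

/-- `λ′·ρλ′ = 1` for `λ′ = lam∕jE δ`, `δ² = D`, `lam·ρlam = jE D` (★ p09), `ρ` fixing `jE δ`. [cite: Rogawski1990, §4.9 Lemma 4.9.3 p. 56] -/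
theorem lprime_mul_map_lprime (hρj : ∀ a, ρ (jE a) = jE a) {t D δ : E} {lam : M} (hlam2 : lam * lam = jE t * lam - jE D)
    (hρlam : ρ lam = jE t - lam) (hδ : δ * δ = D) (hD0 : D ≠ 0) :
    (lam / jE δ) * ρ (lam / jE δ) = 1 := by
  have hδ0 : δ ≠ 0 := fun h => hD0 (by rw [← hδ, h, mul_zero])
  have hjδ : jE δ ≠ 0 := (map_ne_zero jE).2 hδ0
  rw [map_div₀, hρj, div_mul_div_comm, lam_mul_map_lam jE ρ hlam2 hρlam, ← hδ, map_mul, div_self (mul_ne_zero hjδ hjδ)]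

/-- **`ρ𝔩 = −𝔩`** for `𝔩 = λ′ − ρλ′`. [cite: LabesseLanglands1979, §2 p. 8] -/
theorem map_line_eq_neg (hρρ : ∀ z, ρ (ρ z) = z) (x : M) : ρ (x - ρ x) = -(x - ρ x) := by
  rw [map_sub, hρρ]; ring

/-- **`Θ𝔩 = −𝔩`** for `𝔩 = λ′ − ρλ′`, `λ′ = lam∕jE δ`: `Θλ′ = λ′⁻¹ = ρλ′` (`Θlam·lam = 1`, `Θ(jE δ) = jE(σδ) = (jE δ)⁻¹`, `λ′·ρλ′ = 1`, `Θρ = ρΘ`).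
[cite: Rogawski1990, §4.9 Lemma 4.9.3 p. 56] -/
theorem theta_line_eq_neg (hΘρ : ∀ z, Θ (ρ z) = ρ (Θ z)) (hΘj : ∀ a, Θ (jE a) = jE (σ a)) (hρj : ∀ a, ρ (jE a) = jE a)
    {t D δ : E} {lam : M} (hlam2 : lam * lam = jE t * lam - jE D) (hρlam : ρ lam = jE t - lam) (hΘlam : Θ lam * lam = 1)
    (hδ : δ * δ = D) (hσδ : σ δ * δ = 1) (hD0 : D ≠ 0) :
    Θ (lam / jE δ - ρ (lam / jE δ)) = -(lam / jE δ - ρ (lam / jE δ)) := by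
  have hδ0 : δ ≠ 0 := fun h => hD0 (by rw [← hδ, h, mul_zero])
  have hjδ : jE δ ≠ 0 := (map_ne_zero jE).2 hδ0
  have hlam0 : lam ≠ 0 := fun h => by rw [h, mul_zero] at hΘlam; exact zero_ne_one hΘlam
  have hprod := lprime_mul_map_lprime jE ρ hρj hlam2 hρlam hδ hD0
  have hl0 : lam / jE δ ≠ 0 := div_ne_zero hlam0 hjδ
  -- `Θλ′ = (λ′)⁻¹`
  have hΘl : Θ (lam / jE δ) = (lam / jE δ)⁻¹ := by
    have hΘlam' : Θ lam = lam⁻¹ := eq_inv_of_mul_eq_one_left hΘlam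
    have hσδ' : σ δ = δ⁻¹ := eq_inv_of_mul_eq_one_left hσδ
    rw [map_div₀, hΘlam', hΘj, hσδ', map_inv₀]
    field_simp
  -- `ρλ′ = (λ′)⁻¹`
  have hρl : ρ (lam / jE δ) = (lam / jE δ)⁻¹ := (eq_inv_of_mul_eq_one_right hprod)
  rw [map_sub, hΘρ, hΘl, map_inv₀, hρl, inv_inv]
  ring

/-- **`Θ(ρ𝔩) = 𝔩`**: the line generator is `Θρ`-fixed. [cite: LabesseLanglands1979, §2 p. 8] -/
theorem theta_rho_line_eq (hρρ : ∀ z, ρ (ρ z) = z) (hΘρ : ∀ z, Θ (ρ z) = ρ (Θ z)) (hΘj : ∀ a, Θ (jE a) = jE (σ a)) (hρj : ∀ a, ρ (jE a) = jE a)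
    {t D δ : E} {lam : M} (hlam2 : lam * lam = jE t * lam - jE D) (hρlam : ρ lam = jE t - lam) (hΘlam : Θ lam * lam = 1)
    (hδ : δ * δ = D) (hσδ : σ δ * δ = 1) (hD0 : D ≠ 0) :
    Θ (ρ (lam / jE δ - ρ (lam / jE δ))) = lam / jE δ - ρ (lam / jE δ) := by
  rw [map_line_eq_neg ρ hρρ, map_neg, theta_line_eq_neg σ jE ρ Θ hΘρ hΘj hρj hlam2 hρlam hΘlam hδ hσδ hD0, neg_neg]

/-- **`𝔩² = jE((t∕δ − 2)·((t∕δ − 2) + 4))`** (`λ′ + ρλ′ = jE(t∕δ)`, `λ′·ρλ′ = 1`). [cite: LabesseLanglands1979, §2 p. 8] -/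
theorem line_sq_eq (hρj : ∀ a, ρ (jE a) = jE a) {t D δ : E} {lam : M} (hlam2 : lam * lam = jE t * lam - jE D)
    (hρlam : ρ lam = jE t - lam) (hδ : δ * δ = D) (hD0 : D ≠ 0) :
    (lam / jE δ - ρ (lam / jE δ)) ^ 2 = jE ((t / δ - 2) * ((t / δ - 2) + 4)) := by
  have hδ0 : δ ≠ 0 := fun h => hD0 (by rw [← hδ, h, mul_zero])
  have hjδ : jE δ ≠ 0 := (map_ne_zero jE).2 hδ0
  have hprod := lprime_mul_map_lprime jE ρ hρj hlam2 hρlam hδ hD0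
  have hsum : lam / jE δ + ρ (lam / jE δ) = jE (t / δ) := by
    rw [map_div₀, hρj, hρlam, map_div₀]; field_simp; ring
  have key : (lam / jE δ - ρ (lam / jE δ)) ^ 2 = (lam / jE δ + ρ (lam / jE δ)) ^ 2 - 4 * ((lam / jE δ) * ρ (lam / jE δ)) := by ring
  rw [key, hsum, hprod, map_mul, map_add, map_sub, map_div₀, map_ofNat, map_ofNat]
  ring

/-- **`σ(t∕δ) = t∕δ`** from `D·σD = 1`, `t = D·σt`, `δ² = D`, `σδ·δ = 1` — so `a + 2 := t∕δ − 2 + 2` descends to `F`. [cite: Rogawski1990, §3.6 pp. 28–29] -/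
theorem map_trace_div_delta_eq {t D δ : E} (htσ : t = D * σ t) (hδ : δ * δ = D) (hσδ : σ δ * δ = 1) (hD0 : D ≠ 0) : σ (t / δ) = t / δ := by
  have hδ0 : δ ≠ 0 := fun h => hD0 (by rw [← hδ, h, mul_zero])
  have hσδ' : σ δ = δ⁻¹ := eq_inv_of_mul_eq_one_left hσδ
  have hσt : σ t = t / D := by rw [eq_div_iff hD0, mul_comm]; exact htσ.symm
  rw [map_div₀, hσt, hσδ', ← hδ]
  field_simp

/-- O-Sign's letter: `(u² + D − χ)∕(u·δ) = t∕δ` for `χ = u² − t·u + D`, `u ≠ 0`, `δ ≠ 0`. [cite: Rogawski1990, §4.9 p. 55] -/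
theorem oSign_a_letter {u t D δ : E} (hu : u ≠ 0) (hδ0 : δ ≠ 0) : (u ^ 2 + D - (u ^ 2 - t * u + D)) / (u * δ) = t / δ := by
  field_simp; ring

end Line

/-! ## §2 Coordinates of a `Θρ`-fixed element on the line `jE(E^σ) ⊕ jE(E^σ)·𝔩` -/

section Coords

variable {E M : Type*} [Field E] [Field M] (σ : E →+* E) (jE : E →+* M) (ρ Θ : M →+* M)

/-- **EVERY `Θρ`-FIXED `κ` IS `jE A₀ + jE B₀·𝔩` WITH `σA₀ = A₀`, `σB₀ = B₀`** (`𝔩 ≠ 0`, `ρ𝔩 = −𝔩 = Θ𝔩`... `Θ𝔩 = −𝔩`, `2 ≠ 0`; `Fix ρ = jE(E)`, `Θ ∘ jE = jE ∘ σ`).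
[cite: Serre1979, Ch. V §2] [cite: LabesseLanglands1979, §2 p. 8] -/
theorem exists_coords_of_thetaRho_fixed (hρρ : ∀ z, ρ (ρ z) = z) (hΘΘ : ∀ z, Θ (Θ z) = z) (hjfix : ∀ z, ρ z = z ↔ ∃ a, jE a = z)
    (hΘj : ∀ a, Θ (jE a) = jE (σ a)) (h2 : (2 : M) ≠ 0) {l : M} (hl0 : l ≠ 0) (hρl : ρ l = -l) (hΘl : Θ l = -l)
    {κ : M} (hκ : Θ (ρ κ) = κ) :
    ∃ A₀ B₀ : E, σ A₀ = A₀ ∧ σ B₀ = B₀ ∧ κ = jE A₀ + jE B₀ * l := by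
  have hΘκ : Θ κ = ρ κ := by
    have h := congrArg Θ hκ
    rw [hΘΘ] at h
    exact h.symm
  -- the two symmetric coordinates are `ρ`-fixed
  have hρA : ρ ((κ + ρ κ) / 2) = (κ + ρ κ) / 2 := by rw [map_div₀, map_add, hρρ, map_ofNat, add_comm]
  have hρB : ρ ((κ - ρ κ) / (2 * l)) = (κ - ρ κ) / (2 * l) := by
    rw [map_div₀, map_sub, hρρ, map_mul, map_ofNat, hρl, ← neg_sub κ (ρ κ), mul_neg, neg_div_neg_eq]
  obtain ⟨A₀, hA₀⟩ := (hjfix _).1 hρA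
  obtain ⟨B₀, hB₀⟩ := (hjfix _).1 hρB
  -- and `Θ`-fixed, hence `σ`-fixed downstairs
  have hΘA : Θ (jE A₀) = jE A₀ := by rw [hA₀, map_div₀, map_add, hΘκ, hκ, map_ofNat, add_comm]
  have hΘB : Θ (jE B₀) = jE B₀ := by
    rw [hB₀, map_div₀, map_sub, hΘκ, hκ, map_mul, map_ofNat, hΘl, ← neg_sub κ (ρ κ), mul_neg, neg_div_neg_eq]
  refine ⟨A₀, B₀, jE.injective (by rw [← hΘj, hΘA]), jE.injective (by rw [← hΘj, hΘB]), ?_⟩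
  rw [hA₀, hB₀]
  field_simp
  ring

/-- **THE NORM FORM ON THE LINE**: for `κ = jE A₀ + jE B₀·𝔩` with `ρ𝔩 = −𝔩`, `κ·ρκ = (jE A₀ + jE B₀·𝔩)·(jE A₀ − jE B₀·𝔩)`. [cite: Serre1979, Ch. V §2] -/
theorem mul_map_of_coords (hρj : ∀ a, ρ (jE a) = jE a) {l : M} (hρl : ρ l = -l) (A₀ B₀ : E) :
    (jE A₀ + jE B₀ * l) * ρ (jE A₀ + jE B₀ * l) = (jE A₀ + jE B₀ * l) * (jE A₀ - jE B₀ * l) := by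
  rw [map_add, map_mul, hρj, hρj, hρl]; ring

end Coords

end Summit.HodgeConjecture.HodgeConjecture.Cruxes.H413.F0P3cDyRamTypeASignModel

end
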